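import Summits.CriticalPhenomena.PercolationContinuityZ3.Theorems.FK.Transplant.KNFreeCorridorFK
import HarnessLib

/-!
# FRONTIER TRANSPLANT, binder 2 (TP_FK) research line: Kozma–Nitzan's Lemma 12 for `fkLaw · · q` from TARGET MATRICES
# (the two instances of the target property that Lemma 12 actually uses), for the window record

Support file (`--supports stmt-CriticalPhenomena-4575`, helper) of the FRONTIER TRANSPLANT sub-cell
(`fk-continuity/transplant/`, seat `prim-bschramm-fkt-p3`); builds on p205010 (kernel theorem, internal audit signed;
external expert review pending). No definitions, no named facts, no sorries; standard axioms. Registered R55 (cell INBOX,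
2026-08-22); lead label T3m (L14 / R55a); registry row T3w; statement layer read by the design owner fkt-p2 (CONSENT, l.3051).

HONEST FRAMING (page 1, cell rule). The transplant's theorem of record `ufsc0_of_freeBoundaryHypothesis_r3`
(p248245) is CONDITIONAL on FH AND on TP_FK = `KNFreeTargetHittable d q p`, both OPEN at the same `p` for `q > 1`
(⇔ GRC Conj. (5.103) via K1; barrier note `Literature.Barriers.CriticalPhenomena.SamePFreeBoundaryCriteria`,
FBN-01, cited first); the transplant is a typed reduction, not a proof of FK continuity. THIS FILE proves nothing
about FH or TP_FK. It re-reads fkt-p2's law-abstract Lemma 12 (`KNFreeCorridor.lean`: `halvingStepLaw`,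
`halvingChainLaw`, `corridorStepLaw`, `corridorLemmaLaw`) for the law of record `fkLaw · · q` with the target
property `TargetPropertyLaw` REPLACED BY THE TWO TARGET MATRICES its proof consumes — `FKTargetAt d q p δ ε (qfList d) R`
(the `d` halving steps) and `FKTargetAt d q p δ ε (elongList d 88) R` (the corridor step) — so that Lemma 12 for
`fkLaw` becomes available from ANY source of these matrices, in particular from the window theorem
`fkTargetAt_of_isHittable_comparison` (`KNFreeTargetWindow.lean`), whose geometries are `P_{p̃}`-hittable rather
than FK-hittable. Proofs are fkt-p2's, verbatim up to the two call sites of the target property (design credit: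
`KNFreeCorridor.lean`, p245694/p246349 lineage); no hittability hypothesis is needed at all.

* `halvingStep_of_fkTargetAt`, `halvingChain_of_fkTargetAt` — KN p. 24, the halving steps under `restrW A W`;
* `corridorStep_of_fkTargetAt` — KN pp. 24–25, the corridor step under `restrW U W`;
* `fkCorridorRestrAt_of_fkTargetAt` — Lemma 12 for `fkLaw`, conclusion in the restricted form `FKCorridorRestrAt`
  of the record (row 4's matrix), from `∀ ε ∃ δ ∃ R` suppliers of the two matrices.

## References

* G. Kozma, S. Nitzan, arXiv:2401.12397 (2024), §4 Lemma 12 (pp. 23–25) [KozmaNitzan2024].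
* G. Grimmett, *The Random-Cluster Model*, Springer 2006, Thm. (3.21) eq. (3.22) [Grimmett2006].
-/

noncomputable section

open MeasureTheory ProbabilityTheory
open scoped ENNReal

namespace Summit.CriticalPhenomena.PercolationContinuityZ3.Theorems.FK

open Literature.Probability.Percolation Literature.Probability.LatticeModels SimpleGraph
open Literature.Probability.Percolation.KozmaNitzan

variable {d : ℕ}

/-- **One halving step for `fkLaw`, from the quarter-face target matrix** (KN p. 24; fkt-p2's `halvingStepLaw`
with `TargetPropertyLaw` replaced by the matrix `FKTargetAt d q p δ ε (qfList d) R₀` it consumes): whenever the cube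
`B_k` is reached from `o` with probability `> 1 - δ` under the law of `restrW A W`, `B_{k+1}` is reached with
probability `> 1 - ε`. [cite: KozmaNitzan2024, §4 p. 24] -/
theorem halvingStep_of_fkTargetAt [NeZero d] {q : ℝ} (p : unitInterval) {δ ε : ℝ} {R₀ : ℕ}
    (hR₀ : FKTargetAt d q p δ ε (qfList d) R₀) :
    ∀ (S : CData d), S.Hyp p → ∀ (k R : ℕ), k < d → R₀ ≤ R → R₀ ≤ S.lh →
      ((S.r + 1) / 2 : ℕ) + (k : ℤ) * R + R ≤ S.r →
      1 - δ < (fkLaw S.Sfin (restrW (↑S.Aset : Set (Site d)) S.W) q).real (⋃ b ∈ S.Bk k R, openConn S.o b) →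
        1 - ε < (fkLaw S.Sfin (restrW (↑S.Aset : Set (Site d)) S.W) q).real
          (⋃ b ∈ S.Bk (k + 1) R, openConn S.o b) := by
  intro S hS k R hk hR hRlh hfit hB
  have hR' : (R₀ : ℤ) ≤ R := by exact_mod_cast hR
  have hfit0 : ((S.r + 1) / 2 : ℕ) + (k : ℤ) * R + R₀ ≤ S.r := by linarith
  have hkR : (k : ℤ) * R + R₀ ≤ 2 * S.r := by
    have : (0 : ℤ) ≤ ((S.r + 1) / 2 : ℕ) := by positivity
    linarith
  have hkR1 : ((k + 1 : ℕ) : ℤ) * R ≤ 2 * S.r := by push_cast; linarith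
  exact hR₀ (restrW (↑S.Aset : Set (Site d)) S.W) S.Sfin S.nearQ (S.c - S.hwid k R) (S.c + S.hwid k R)
    (S.Bk (k + 1) R) S.o (finSupp_of_le (restrW_le _ _) hS.fin)
    ((CData.isSubbox_nearQ hS).restrW (Finset.coe_subset.2 (CData.nearQ_subset_Aset hS)))
    (S.nearQ_subset_bigD.trans hS.DS) hS.o_mem (CData.o_not_mem_nearQ hS)
    (S.enlarge_Bk_subset_nearQ hkR) (S.isTarget_halving hk hR hRlh hfit0) (S.Bk_subset_nearQ hkR1)
    (S.Bk_nonempty _ _) hB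

/-- **The chain of halving steps for `fkLaw`, from a supplier of quarter-face target matrices**: `n` steps from
`B_k` to `B_{k+n}` (`k + n ≤ d`); fkt-p2's `halvingChainLaw` with the target property replaced by
`∀ ε ∃ δ ∃ R₀, FKTargetAt d q p δ ε (qfList d) R₀`.
[cite: KozmaNitzan2024, §4 p. 24 ("We continue this way, each time halving one dimension")] -/
theorem halvingChain_of_fkTargetAt [NeZero d] {q : ℝ} (p : unitInterval)
    (hTq : ∀ ⦃ε : ℝ⦄, 0 < ε → ∃ δ : ℝ, 0 < δ ∧ ∃ R₀ : ℕ, FKTargetAt d q p δ ε (qfList d) R₀)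
    (n : ℕ) {ε : ℝ} (hε : 0 < ε) :
    ∃ δ : ℝ, 0 < δ ∧ ∃ R₀ : ℕ, ∀ (S : CData d), S.Hyp p → ∀ (k R : ℕ), k + n ≤ d → R₀ ≤ R → R₀ ≤ S.lh →
      ((S.r + 1) / 2 : ℕ) + (d : ℤ) * R + R ≤ S.r →
      1 - δ < (fkLaw S.Sfin (restrW (↑S.Aset : Set (Site d)) S.W) q).real (⋃ b ∈ S.Bk k R, openConn S.o b) →
        1 - ε < (fkLaw S.Sfin (restrW (↑S.Aset : Set (Site d)) S.W) q).real
          (⋃ b ∈ S.Bk (k + n) R, openConn S.o b) := by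
  induction n generalizing ε with
  | zero =>
    refine ⟨ε, hε, 0, fun S _ k R _ _ _ _ hB => ?_⟩
    simpa using hB
  | succ n ih =>
    obtain ⟨δ', hδ', R₁, h1⟩ := ih hε
    obtain ⟨δ, hδ, R₂, hR₂⟩ := hTq hδ'
    have h2 := halvingStep_of_fkTargetAt (q := q) p hR₂
    refine ⟨δ, hδ, max R₁ R₂, fun S hS k R hkn hR hRlh hfit hB => ?_⟩
    have hfitk : ((S.r + 1) / 2 : ℕ) + (k : ℤ) * R + R ≤ S.r := by
      have : (k : ℤ) * R ≤ (d : ℤ) * R :=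
        mul_le_mul_of_nonneg_right (by exact_mod_cast (by omega : k ≤ d)) (by positivity)
      linarith
    have step := h2 S hS k R (by omega) (le_of_max_le_right hR) ((le_max_right _ _).trans hRlh) hfitk hB
    have rest := h1 S hS (k + 1) R (by omega) (le_of_max_le_left hR) ((le_max_left _ _).trans hRlh) hfit step
    have e : k + 1 + n = k + (n + 1) := by ring
    rw [e] at rest
    exact rest

/-- **The corridor step for `fkLaw`, from the aspect-`88` target matrix** (KN pp. 24–25; fkt-p2's
`corridorStepLaw` with the target property replaced by the matrix `FKTargetAt d q p δ ε (elongList d 88) R₀` it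
consumes — no hittability of the elongated geometries is needed here, only the matrix).
[cite: KozmaNitzan2024, §4 pp. 24–25] -/
theorem corridorStep_of_fkTargetAt [NeZero d] {q : ℝ} (p : unitInterval) {δ ε : ℝ} {R₀ : ℕ}
    (hR₀ : FKTargetAt d q p δ ε (elongList d 88 (by norm_num)) R₀) :
    ∀ (S : CData d), S.Hyp p → ∀ R : ℕ, 44 ≤ S.r → 5 * R₀ + 5 ≤ S.r →
      4 * ((S.lh : ℤ) + d * R + R₀) + 4 ≤ 7 * S.r →
      1 - δ < (fkLaw S.Sfin (restrW (↑S.Uset : Set (Site d)) S.W) q).real (⋃ b ∈ S.Bk d R, openConn S.o b) →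
        1 - ε < (fkLaw S.Sfin (restrW (↑S.Uset : Set (Site d)) S.W) q).real
          (⋃ b ∈ S.Tn (2 * S.r), openConn S.o b) := by
  intro S hS R h44 hRc hΔ hB
  have hw : ∀ i, S.hwid d R i = S.lh + d * R := fun i => by rw [S.hwid_apply, if_pos i.2]
  have hRc' : 5 * (R₀ : ℤ) + 5 ≤ S.r := by exact_mod_cast hRc
  have hencl : Finset.Icc (S.c - S.hwid d R - (R₀ : Site d)) (S.c + S.hwid d R + (R₀ : Site d)) ⊆ S.Dcorr := by
    intro x hx
    rw [mem_Icc_iff] at hx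
    simp only [Pi.sub_apply, Pi.add_apply, Pi.natCast_apply] at hx
    rw [S.mem_Dcorr_iff]
    have hlh : (0 : ℤ) ≤ S.lh := by positivity
    refine ⟨?_, fun j hj => ?_⟩
    · have := hx S.a; rw [hw] at this
      have hb := level_bounds_of_abs_le S.hσ (x := S.c S.a) (y := x S.a) (ℓ := S.lh + d * R + R₀)
        (by linarith) (by linarith)
      have e : S.σ * (x S.a - S.c S.a) = S.σ * x S.a - S.σ * S.c S.a := by ring
      rw [e]; constructor <;> linarith [hb.1, hb.2]
    · have := hx j; rw [hw] at this
      constructor <;> linarith [this.1, this.2]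
  have hTD : S.Tn (2 * S.r) ⊆ S.Dcorr := by
    intro x hx
    rw [S.mem_Tn_iff] at hx
    rw [S.mem_Dcorr_iff]
    push_cast at hx
    refine ⟨⟨by linarith [hx.1.1], by linarith [hx.1.2]⟩, fun j hj => ?_⟩
    have := hx.2 j hj
    constructor <;> linarith [this.1, this.2]
  exact hR₀ (restrW (↑S.Uset : Set (Site d)) S.W) S.Sfin S.Dcorr (S.c - S.hwid d R) (S.c + S.hwid d R)
    (S.Tn (2 * S.r)) S.o (finSupp_of_le (restrW_le _ _) hS.fin)
    ((CData.isSubbox_Dcorr hS).restrW (Finset.coe_subset.2 (CData.Dcorr_subset_Uset hS)))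
    ((CData.Dcorr_subset_Uset hS).trans (CDataFK.Uset_subset_Sfin hS)) hS.o_mem (CData.o_not_mem_Dcorr hS)
    hencl (S.isTarget_corridor h44 hRc hΔ) hTD (S.Tn_nonempty _) hB

/-- **Kozma–Nitzan's Lemma 12 for `fkLaw Λ W q` (`1 ≤ q`) from suppliers of the two target matrices**, in the
restricted form of the record (row 4's matrix `FKCorridorRestrAt d q p δ ε m`): for every `ε > 0` there are
`δ > 0` and `m` such that for every corridor datum `S` at `p` of scale `r ≥ m`,
`φ_{Sfin, W|_A}(o ↔ c + [-3r,3r]^d) > 1 - δ ⟹ φ_{Sfin, W|_U}(o ↔ Tn(3r)) > 1 - ε` — `d` halving steps under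
`W|_A` (`halvingChain_of_fkTargetAt`), weight monotonicity `W|_A ≤ W|_U` (Grimmett (3.22), `lawMono_fkLaw`), the
corridor step under `W|_U` (`corridorStep_of_fkTargetAt`). fkt-p2's `corridorLemmaLaw`, verbatim up to the source
of the matrices. [cite: KozmaNitzan2024, §4 Lemma 12 (pp. 23–25); Grimmett2006, Thm. (3.21) eq. (3.22)] -/
theorem fkCorridorRestrAt_of_fkTargetAt [NeZero d] {q : ℝ} (hq : 1 ≤ q) (p : unitInterval)
    (hTq : ∀ ⦃ε : ℝ⦄, 0 < ε → ∃ δ : ℝ, 0 < δ ∧ ∃ R₀ : ℕ, FKTargetAt d q p δ ε (qfList d) R₀)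
    (hTe : ∀ ⦃ε : ℝ⦄, 0 < ε → ∃ δ : ℝ, 0 < δ ∧ ∃ R₀ : ℕ, FKTargetAt d q p δ ε (elongList d 88 (by norm_num)) R₀)
    {ε : ℝ} (hε : 0 < ε) :
    ∃ δ : ℝ, 0 < δ ∧ ∃ m : ℕ, FKCorridorRestrAt d q p δ ε m := by
  have hq0 : 0 < q := one_pos.trans_le hq
  obtain ⟨δc, hδc, Rc, hRc⟩ := hTe hε
  have hcorr := corridorStep_of_fkTargetAt (q := q) p hRc
  obtain ⟨δh, hδh, Rh, hhalf⟩ := halvingChain_of_fkTargetAt (q := q) p hTq d hδc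
  set R : ℕ := max Rc Rh with hRdef
  refine ⟨δh, hδh, 100 * (d + 1) * (R + 1), fun S hS hm hA => ?_⟩
  -- arithmetic
  have hR1 : Rc ≤ R := le_max_left _ _
  have hR2 : Rh ≤ R := le_max_right _ _
  have hm' : 100 * ((d : ℤ) + 1) * (R + 1) ≤ S.r := by exact_mod_cast hm
  have hd0 : (0 : ℤ) ≤ d := by positivity
  have hR0 : (0 : ℤ) ≤ R := by positivity
  have hdR : (0 : ℤ) ≤ d * R := by positivity
  have hexp : 100 * ((d : ℤ) + 1) * (R + 1) = 100 * (d * R) + 100 * d + 100 * R + 100 := by ring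
  have hlh := S.two_lh
  have hhalf' : (((S.r + 1) / 2 : ℕ) : ℤ) + (S.r : ℤ) = S.lh := by unfold CData.lh; push_cast; ring
  have hRc' : (Rc : ℤ) ≤ R := by exact_mod_cast hR1
  have hRh' : (Rh : ℤ) ≤ R := by exact_mod_cast hR2
  -- the hypothesis, as the cube `B_0`
  have h0 : 1 - δh < (fkLaw S.Sfin (restrW (↑S.Aset : Set (Site d)) S.W) q).real
      (⋃ b ∈ S.Bk 0 R, openConn S.o b) := by
    rw [S.Bk_zero]
    exact hA
  -- the halving chain
  have h1 := hhalf S hS 0 R (by omega) hR2 ?_ ?_ h0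
  rotate_left
  · have : (R : ℤ) ≤ S.lh := by linarith
    have : (Rh : ℤ) ≤ S.lh := by linarith
    exact_mod_cast this
  · have hdRh : (d : ℤ) * R ≤ d * R := le_rfl
    linarith
  rw [zero_add] at h1
  -- from `A` to `U`: the weighting restricted to `U` dominates the one restricted to `A`
  haveI := isProbabilityMeasure_fkLaw S.Sfin (restrW (↑S.Uset : Set (Site d)) S.W) hq0
  have h2 : 1 - δc < (fkLaw S.Sfin (restrW (↑S.Uset : Set (Site d)) S.W) q).real
      (⋃ b ∈ S.Bk d R, openConn S.o b) :=
    h1.trans_le (lawMono_fkLaw hq (restrW_mono_set (Finset.coe_subset.2 S.Aset_subset_Uset) S.W)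
      (isUpperSet_biUnion_openConn _ _) (measurableSet_biUnion_openConn _ _))
  -- the corridor step
  have h3 := hcorr S hS R ?_ ?_ ?_ h2
  rotate_left
  · have : (44 : ℤ) ≤ S.r := by linarith
    exact_mod_cast this
  · have : 5 * (Rc : ℤ) + 5 ≤ S.r := by linarith
    exact_mod_cast this
  · have : (d : ℤ) * Rc ≤ d * R := mul_le_mul_of_nonneg_left hRc' hd0
    nlinarith
  -- the larger target cube
  refine h3.trans_le (measureReal_mono ?_ (measure_ne_top _ _))
  intro ω hω
  simp only [Set.mem_iUnion, exists_prop] at hω ⊢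
  obtain ⟨x, hx, hω⟩ := hω
  refine ⟨x, ?_, hω⟩
  rw [S.mem_Tn_iff] at hx ⊢
  push_cast at hx ⊢
  refine ⟨⟨by linarith [hx.1.1], by linarith [hx.1.2]⟩, fun j hj => ?_⟩
  have := hx.2 j hj
  constructor <;> linarith [this.1, this.2]

end Summit.CriticalPhenomena.PercolationContinuityZ3.Theorems.FK

end
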